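import Literature.Computability.AlgebraicComplexity.IK2020ContentSubspaceProofs
import Literature.Computability.AlgebraicComplexity.BI17PowerSumStabilizerProofs
import Literature.NumberTheory.DiophantineGeometry.GLHighestWeightExistsUniqueProofs
import Literature.NumberTheory.DiophantineGeometry.SchurWeylPlethysmPolynomialProofs
import Literature.NumberTheory.DiophantineGeometry.GLHighestWeightFacts
import Literature.NumberTheory.DiophantineGeometry.TensorWordModel
import Mathlib.RingTheory.RootsOfUnity.Complex
import Mathlib.LinearAlgebra.PiTensorProduct.Finite
import Mathlib.Data.Fin.Tuple.Sort
import HarnessLib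

/-!
# Ikenmeyer–Kandasamy 2020, §9: `{λ}^H = ⊕_ϱ (W'_ϱ)^{𝔖_m}` for the power sum (proofs)

Theorem-only companion of `IK20HighestWeightVectors.lean` (definitions of record:
`IK2020.weylInvariantDim`, `IK2020.contentSubspace`, `IK2020.permFixed`, `IK2020.bCoeff`, and the
named facts `IK2020_prop_4_1`, `IK2020_prop_10_1`). We formalize the subsection
"The coordinate ring of the orbit of the power sum" of IK §9 (TeX L801–820) and the resulting
Prop. 9.2 / first lines of §10, on the tree's dictionary `mult_{λ^*} ℂ[Gp] ↔ dim {λ}^H`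
(`H = stab p`, `p = x₁^D + ⋯ + x_m^D`):

* IK L804–805: "The group `H` is the semidirect product [`ℤ_D^m ⋊ 𝔖_m`, §3 L338] …
  `{λ}^H = ({λ}^{ℤ_D^m})^{𝔖_m}`, which enables us to analyze `{λ}^H` via a two-step process by
  first analyzing `{λ}^{ℤ_D^m}` and then taking `𝔖_m`-invariants."  Tree: `H` is generated by the
  permutation matrices and the diagonal matrices of `D`-th roots of unity
  (`linStabilizer_psum_eq_closure`, BI 2017 Prop. 2.4(2), file `BI17PowerSumStabilizerProofs`), and
  the invariants of a subgroup generated by a set are the common fixed vectors of the set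
  (`invariants_weylRep_psum_eq_permFixed`).
* IK L806–812: "`{λ}^{ℤ_D^m}` has a basis given by semistandard tableaux of shape `λ` in which each
  number appears a multiple of `D` many times."  Tree (tableau of content `γ` = weight vector of
  weight `γ`): for ANY finite-dimensional rational representation of `GL_m(k)`, `k` containing a
  primitive `D`-th root of unity, the vectors fixed by the diagonal `D`-torsion torus are exactly
  `⊕_{γ : D ∣ γ} W^γ` (`iInf_eqLocus_rootDiagonal_eq_iSup_weightSpace`, via the tree's weight
  projectors `exists_weightProj`).
* IK L813–814: "For a partition `ϱ` let `W'_ϱ` denote the linear space spanned by all semistandard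
  tableaux of shape `λ` whose sorted content is `ϱD`. This gives a decomposition
  `{λ}^{ℤ_D^m} = ⊕_ϱ W'_ϱ` as a direct sum."  Tree: `W'_ϱ = IK2020.contentSubspace k m D λ ϱ`;
  `iSup_weightSpace_dvd_eq_iSup_contentSubspace` (the weights of `{λ} ⊆ (k^m)^{⊗dD}` are contents,
  word model `TensorWordModel`) and `contentSubspace_independent` (directness: weight vectors of
  distinct weights are independent, `IK2020.eq_zero_of_sum_weightVectors_eq_zero`).
* IK L814–816: "The action of `𝔖_m` leaves `W'_ϱ` fixed. Hence
  `({λ}^{ℤ_D^m})^{𝔖_m} = ⊕_ϱ (W'_ϱ)^{𝔖_m}`."  Tree: `weylRep_permGL_mem_contentSubspace`,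
  `finrank_permFixed_iSup_contentSubspace_eq_sum`.
* Conclusion (Prop. 9.2, TeX L822–835, in the dimension form used at §10 L844–846 "we prove
  Proposition 4.1 … we prove a slightly stronger result", Prop. 10.1):
  `dim {λ}^H = ∑_{ϱ ⊢_m d} dim (W'_ϱ)^{𝔖_m}` UNCONDITIONALLY
  (`weylInvariantDim_psum_eq_sum_finrank_permFixed`), and hence the reduction
  `IK2020_prop_4_1_of_prop_10_1 : IK2020_prop_10_1 → IK2020_prop_4_1` — the printed proof of
  Prop. 4.1 modulo its one Schur–Weyl ingredient Prop. 10.1 (which stays a named fact).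

No new definitions, no named facts; everything here is proved.

## References
* C. Ikenmeyer, U. Kandasamy, *Implementing geometric complexity theory: on the separation of
  orbit closures via symmetries*, STOC 2020, arXiv:1911.03990, §9 (TeX L801–835), §10 (L844–846).
  [IkenmeyerKandasamy2019]
* P. Bürgisser, C. Ikenmeyer, *Fundamental invariants of orbit closures*, J. Algebra 477 (2017),
  Prop. 2.4(2). [BurgisserIkenmeyer2017]
* W. Fulton, J. Harris, *Representation Theory*, GTM 129, §15.3 (weights, Weyl group).
  [FultonHarrisGTM129]
-/

noncomputable section

open scoped BigOperators
open MvPolynomial Module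

namespace Literature.Computability.AlgebraicComplexity

open _root_.Literature.NumberTheory.DiophantineGeometry

namespace IK2020

/-! ## §0. Invariants of a subgroup generated by a set -/

section Closure

variable {k G V : Type*} [CommRing k] [Group G] [AddCommGroup V] [Module k V]

/-- The invariants of `⟨S⟩` are the common fixed vectors of `S`. [folklore] -/
private theorem mem_invariants_comp_subtype_closure_iff (ρ : Representation k G V) (S : Set G)
    (v : V) :
    v ∈ Representation.invariants (ρ.comp (Subgroup.closure S).subtype) ↔ ∀ s ∈ S, ρ s v = v := by
  rw [Representation.mem_invariants]
  constructor
  · intro hv s hs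
    exact hv ⟨s, Subgroup.subset_closure hs⟩
  · rintro hv ⟨g, hg⟩
    change ρ g v = v
    induction hg using Subgroup.closure_induction with
    | mem x hx => exact hv x hx
    | one => simp
    | mul x y _ _ hx hy => rw [map_mul, Module.End.mul_apply, hy, hx]
    | inv x _ hx =>
      calc ρ x⁻¹ v = ρ x⁻¹ (ρ x v) := by rw [hx]
        _ = v := by rw [← Module.End.mul_apply, ← map_mul, inv_mul_cancel, map_one,
                Module.End.one_apply]

end Closure

/-! ## §1. Vectors fixed by the `D`-torsion torus (any rational representation) -/

section Torus

variable {k : Type*} [Field k] {m : ℕ} {V : Type*} [AddCommGroup V] [Module k V]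
  (ρ : Representation k (GL (Fin m) k) V)

/-- A `GL_m` element whose matrix is diagonal lies in the torus. [folklore] -/
private theorem isDiagonalGL_of_coe_eq_diagonal {t : GL (Fin m) k} {d : Fin m → k}
    (ht : (t : Matrix (Fin m) (Fin m) k) = Matrix.diagonal d) : IsDiagonalGL t := by
  rw [isDiagonalGL_iff_isDiag, ht]
  exact Matrix.isDiag_diagonal d

/-- On a diagonal matrix of `D`-th roots of unity every weight divisible by `D` is trivial.
[folklore] -/
private theorem weightChar_eq_one_of_dvd {D : ℕ} {γ : Weight (Fin m)} (hγ : ∀ i, (D : ℤ) ∣ γ i)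
    {t : GL (Fin m) k} {d : Fin m → k} (ht : (t : Matrix (Fin m) (Fin m) k) = Matrix.diagonal d)
    (hd : ∀ i, d i ^ D = 1) : weightChar γ t = 1 := by
  unfold weightChar
  refine Finset.prod_eq_one fun i _ => ?_
  obtain ⟨c, hc⟩ := hγ i
  rw [ht, Matrix.diagonal_apply_eq, hc, zpow_mul, zpow_natCast, hd i, one_zpow]

/-- The diagonal element `diag(1, …, ζ, …, 1)` (`ζ` at position `i`) of `GL_m`. [folklore] -/
private theorem det_diagonal_update_ne_zero {ζ : k} (hζ : ζ ≠ 0) (i : Fin m) :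
    (Matrix.diagonal (Function.update (fun _ : Fin m => (1 : k)) i ζ)).det ≠ 0 := by
  rw [Matrix.det_diagonal]
  refine Finset.prod_ne_zero_iff.mpr fun j _ => ?_
  rcases eq_or_ne j i with rfl | hji
  · rwa [Function.update_self]
  · rw [Function.update_of_ne hji]
    exact one_ne_zero

/-- The weight character of `diag(1, …, ζ, …, 1)` (`ζ` at position `i`) is `ζ^{γ_i}`. [folklore] -/
private theorem weightChar_diagonal_update {ζ : k} (hζ : ζ ≠ 0) (i : Fin m) (γ : Weight (Fin m)) :
    weightChar γ (Matrix.GeneralLinearGroup.mkOfDetNeZero _ (det_diagonal_update_ne_zero hζ i)) =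
      ζ ^ (γ i) := by
  unfold weightChar
  rw [Finset.prod_eq_single i]
  · simp [Matrix.diagonal_apply_eq]
  · intro j _ hji
    simp [Matrix.diagonal_apply_eq, Function.update_of_ne hji]
  · intro h
    exact absurd (Finset.mem_univ i) h

/-- **IK §9 (TeX L806–812), general form: the vectors fixed by the `D`-torsion torus are the
weight spaces of weights divisible by `D`.** Let `ρ` be a finite-dimensional rational
representation of `GL_m(k)` and let `k` contain a primitive `D`-th root of unity `ζ`. Then the
common fixed space of the diagonal matrices `diag(t)` with `t_i^D = 1` equals `⊕_{γ : D ∣ γ_i ∀ i} W^γ`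
("if any symbol in the tableau `S` does not occur a multiple of `D` times, then `S` vanishes under
the symmetrization over `ℤ_D^m` …; each `S` in which every number appears a multiple of `D` many
times is fixed"). The inclusion `⊇` is the computation `∏ t_i^{γ_i} = ∏ (t_i^D)^{γ_i/D} = 1`; for `⊆`
decompose `v = ∑_μ A_μ v` by the weight projectors (tree `exists_weightProj`) and test with
`diag(1,…,ζ,…,1)`: `A_μ v = ζ^{μ_i} A_μ v` forces `A_μ v = 0` unless `D ∣ μ_i`.
[cite: IkenmeyerKandasamy2019, §9 (TeX L806–812)] -/
theorem iInf_eqLocus_rootDiagonal_eq_iSup_weightSpace [Infinite k] [FiniteDimensional k V]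
    (hρ : IsRationalRep ρ) {D : ℕ} (hD : D ≠ 0) {ζ : k} (hζ : IsPrimitiveRoot ζ D) :
    (⨅ t ∈ {t : GL (Fin m) k | ∃ d : Fin m → k,
        (t : Matrix (Fin m) (Fin m) k) = Matrix.diagonal d ∧ ∀ i, d i ^ D = 1},
      LinearMap.eqLocus (ρ t) LinearMap.id) =
      ⨆ (γ : Weight (Fin m)) (_ : ∀ i, (D : ℤ) ∣ γ i), weightSpace ρ γ := by
  classical
  apply le_antisymm
  · intro v hv
    simp only [Submodule.mem_iInf, LinearMap.mem_eqLocus, LinearMap.id_coe, id_eq,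
      Set.mem_setOf_eq] at hv
    obtain ⟨S, A, hsum, hleft, hright⟩ := exists_weightProj hρ
    have hvsum : v = ∑ μ ∈ S, A μ v := by
      have := congrArg (fun f : Module.End k V => f v) hsum
      simpa only [LinearMap.coe_sum, Finset.sum_apply, Module.End.one_apply] using this.symm
    rw [hvsum]
    refine Submodule.sum_mem _ fun μ hμ => ?_
    by_cases hdiv : ∀ i, (D : ℤ) ∣ μ i
    · have hmem : A μ v ∈ weightSpace ρ μ := by
        intro t ht
        change (ρ t * A μ) v = _
        rw [hleft μ hμ t ht]
        rfl
      exact Submodule.mem_iSup_of_mem μ (Submodule.mem_iSup_of_mem hdiv hmem)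
    · obtain ⟨i, hi⟩ := not_forall.mp hdiv
      have hζ0 : ζ ≠ 0 := hζ.ne_zero hD
      set t : GL (Fin m) k :=
        Matrix.GeneralLinearGroup.mkOfDetNeZero _ (det_diagonal_update_ne_zero hζ0 i) with ht_def
      have htd : IsDiagonalGL t := isDiagonalGL_of_coe_eq_diagonal (d := Function.update _ i ζ)
        (Matrix.GeneralLinearGroup.val_mkOfDetNeZero _ _)
      have htv : ρ t v = v := by
        refine hv t ⟨Function.update (fun _ => (1 : k)) i ζ,
          Matrix.GeneralLinearGroup.val_mkOfDetNeZero _ _, fun j => ?_⟩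
        rcases eq_or_ne j i with rfl | hji
        · rw [Function.update_self, hζ.pow_eq_one]
        · rw [Function.update_of_ne hji, one_pow]
      have key : A μ v = ζ ^ (μ i) • A μ v := by
        conv_lhs => rw [← htv]
        change (A μ * ρ t) v = _
        rw [hright μ hμ t htd, ← weightChar_diagonal_update hζ0 i μ]
        rfl
      have hne : ζ ^ (μ i) ≠ 1 := by
        rw [Ne, hζ.zpow_eq_one_iff_dvd]
        exact hi
      have hzero : A μ v = 0 := by
        have h2 : (ζ ^ (μ i) - 1) • A μ v = 0 := by
          rw [sub_smul, one_smul, ← key, sub_self]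
        exact (smul_eq_zero.mp h2).resolve_left (sub_ne_zero.mpr hne)
      rw [hzero]
      exact Submodule.zero_mem _
  · refine iSup₂_le fun γ hγ => fun v hv => ?_
    simp only [Submodule.mem_iInf, LinearMap.mem_eqLocus, LinearMap.id_coe, id_eq,
      Set.mem_setOf_eq]
    rintro t ⟨d, htd, hd⟩
    rw [hv t (isDiagonalGL_of_coe_eq_diagonal htd), weightChar_eq_one_of_dvd hγ htd hd, one_smul]

end Torus

/-! ## §2. Independent blocks of weight spaces and their fixed vectors (linear algebra) -/

section Blocks

variable {k : Type*} [Field k] {m : ℕ} {V : Type*} [AddCommGroup V] [Module k V]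
  (ρ : Representation k (GL (Fin m) k) V)

/-- Sums of weight spaces over pairwise disjoint finite sets of weights are independent: if
`∑_i v_i = 0` with `v_i ∈ ⊕_{γ ∈ O_i} W^γ` and the `O_i` pairwise disjoint, then every `v_i = 0`
(weight vectors of distinct weights are linearly independent, tree
`IK2020.eq_zero_of_sum_weightVectors_eq_zero`). [folklore] -/
private theorem eq_zero_of_sum_mem_iSup_weightSpace [Infinite k] {ι : Type*} (R : Finset ι)
    (O : ι → Finset (Weight (Fin m)))
    (hO : ∀ i ∈ R, ∀ j ∈ R, i ≠ j → Disjoint (O i) (O j))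
    (v : ι → V) (hv : ∀ i ∈ R, v i ∈ ⨆ γ ∈ O i, weightSpace ρ γ) (h0 : ∑ i ∈ R, v i = 0) :
    ∀ i ∈ R, v i = 0 := by
  classical
  have hex : ∀ i, i ∈ R → ∃ u : (γ : Weight (Fin m)) → weightSpace ρ γ,
      ∑ γ ∈ O i, (u γ : V) = v i := fun i hi =>
    (Submodule.mem_iSup_finset_iff_exists_sum _ _).mp (hv i hi)
  choose! u hu using hex
  set w : Weight (Fin m) → V := fun γ => ∑ i ∈ R, if γ ∈ O i then (u i γ : V) else 0 with hw
  have hwmem : ∀ γ, w γ ∈ weightSpace ρ γ := fun γ =>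
    Submodule.sum_mem _ fun i _ => by
      split_ifs
      · exact (u i γ).2
      · exact Submodule.zero_mem _
  have hwsum : ∑ γ ∈ R.biUnion O, w γ = 0 := by
    simp only [hw]
    rw [Finset.sum_comm]
    calc ∑ i ∈ R, ∑ γ ∈ R.biUnion O, (if γ ∈ O i then (u i γ : V) else 0)
        = ∑ i ∈ R, v i := Finset.sum_congr rfl fun i hi => by
          rw [Finset.sum_ite_mem, Finset.inter_eq_right.mpr (Finset.subset_biUnion_of_mem O hi),
            hu i hi]
      _ = 0 := h0
  have hw0 := eq_zero_of_sum_weightVectors_eq_zero ρ (R.biUnion O) w (fun γ _ => hwmem γ) hwsum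
  intro i hi
  rw [← hu i hi]
  refine Finset.sum_eq_zero fun γ hγ => ?_
  have hwγ : w γ = (u i γ : V) := by
    simp only [hw]
    rw [Finset.sum_eq_single i]
    · rw [if_pos hγ]
    · intro j hj hji
      rw [if_neg]
      exact fun hγj => (Finset.disjoint_left.mp (hO i hi j hj (Ne.symm hji)) hγ) hγj
    · intro h
      exact absurd hi h
  rw [← hwγ]
  exact hw0 γ (Finset.mem_biUnion.mpr ⟨i, hi, hγ⟩)

/-- **Fixed vectors distribute over an invariant independent finite sum.** If the submodules
`B_i` (`i ∈ R`) are independent and each is stable under every operator `T_a`, then the vectors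
of `⊕_i B_i` fixed by all `T_a` are `⊕_i (B_i)^{T}`, so the dimensions add up. [folklore] -/
private theorem finrank_iSup_inf_eq_sum [FiniteDimensional k V] {ι τ : Type*} (R : Finset ι)
    (B : ι → Submodule k V)
    (hind : ∀ v : ι → V, (∀ i ∈ R, v i ∈ B i) → ∑ i ∈ R, v i = 0 → ∀ i ∈ R, v i = 0)
    (T : τ → Module.End k V) (hT : ∀ a, ∀ i ∈ R, ∀ v ∈ B i, T a v ∈ B i)
    (F : Submodule k V) (memF : ∀ v, v ∈ F ↔ ∀ a, T a v = v) :
    finrank k ↥((⨆ i ∈ R, B i) ⊓ F) = ∑ i ∈ R, finrank k ↥(B i ⊓ F) := by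
  classical
  let φ : (Π i : R, ↥(B i ⊓ F)) →ₗ[k] V :=
    { toFun := fun x => ∑ i : R, ((x i : ↥(B (i : ι) ⊓ F)) : V)
      map_add' := fun x y => by simp [Finset.sum_add_distrib]
      map_smul' := fun c x => by simp [Finset.smul_sum] }
  have hφ : ∀ x, φ x = ∑ i : R, ((x i : ↥(B (i : ι) ⊓ F)) : V) := fun x => rfl
  have hφmem : ∀ x, φ x ∈ (⨆ i ∈ R, B i) ⊓ F := by
    intro x
    rw [hφ]
    refine Submodule.mem_inf.mpr ⟨Submodule.sum_mem _ fun i _ => ?_,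
      Submodule.sum_mem _ fun i _ => (Submodule.mem_inf.mp (x i).2).2⟩
    exact Submodule.mem_iSup_of_mem (i : ι)
      (Submodule.mem_iSup_of_mem i.2 (Submodule.mem_inf.mp (x i).2).1)
  let ψ : (Π i : R, ↥(B i ⊓ F)) →ₗ[k] ↥((⨆ i ∈ R, B i) ⊓ F) := φ.codRestrict _ hφmem
  have hinj : Function.Injective ψ := by
    rw [← LinearMap.ker_eq_bot, LinearMap.ker_codRestrict, LinearMap.ker_eq_bot']
    intro x hx
    rw [hφ] at hx
    set v : ι → V := fun i => if h : i ∈ R then ((x ⟨i, h⟩ : ↥(B i ⊓ F)) : V) else 0 with hv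
    have hvx : ∀ i : R, v i = ((x i : ↥(B (i : ι) ⊓ F)) : V) := fun i => by
      simp only [hv, dif_pos i.2]
    have hv0 : ∑ i ∈ R, v i = 0 := by
      rw [← Finset.sum_coe_sort, ← hx]
      exact Finset.sum_congr rfl fun i _ => hvx i
    have hvi := hind v (fun i hi => by
      simpa only [hv, dif_pos hi] using (Submodule.mem_inf.mp (x ⟨i, hi⟩).2).1) hv0
    funext i
    apply Subtype.ext
    rw [← hvx i]
    exact hvi i i.2
  have hsurj : Function.Surjective ψ := by
    rintro ⟨y, hy⟩
    obtain ⟨hy1, hy2⟩ := Submodule.mem_inf.mp hy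
    obtain ⟨μ, hμ⟩ := (Submodule.mem_iSup_finset_iff_exists_sum _ _).mp hy1
    have hfix : ∀ i ∈ R, ∀ a, T a (μ i : V) = μ i := by
      intro i hi a
      have hsum0 : ∑ j ∈ R, (T a (μ j : V) - μ j) = 0 := by
        rw [Finset.sum_sub_distrib, ← map_sum, hμ, (memF y).mp hy2 a, sub_self]
      exact sub_eq_zero.mp (hind (fun j => T a (μ j : V) - μ j)
        (fun j hj => Submodule.sub_mem _ (hT a j hj _ (μ j).2) (μ j).2) hsum0 i hi)
    refine ⟨fun i => ⟨μ i, Submodule.mem_inf.mpr ⟨(μ (i : ι)).2, (memF _).mpr (hfix i i.2)⟩⟩,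
      Subtype.ext ?_⟩
    change φ _ = y
    rw [hφ, ← hμ, ← Finset.sum_coe_sort R]
  rw [← LinearEquiv.finrank_eq (LinearEquiv.ofBijective ψ ⟨hinj, hsurj⟩),
    Module.finrank_pi_fintype, ← Finset.sum_coe_sort R]

end Blocks

/-! ## §3. The blocks `W'_ϱ = {λ}_ϱ` of the Weyl module -/

section Content

variable {k : Type*} [Field k] {m : ℕ}

/-- The weights of the Weyl module `{λ} ⊆ (k^m)^{⊗n}` are contents of words: if `W^γ ≠ 0` then
`γ = content(w)` for some word `w ∈ [m]^n` (characteristic zero; coordinate model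
`TensorWordModel`, `apply_eq_zero_of_mem_weightSpace`). [folklore] -/
private theorem exists_wordContent_of_weightSpace_ne_bot [CharZero k] {n : ℕ}
    (lam : Nat.Partition n) {γ : Weight (Fin m)}
    (h : weightSpace (V := weylModule k (Fin m) lam) (weylRep k (Fin m) lam) γ ≠ ⊥) :
    ∃ w : Word m n, ∀ i, γ i = wordContent w i := by
  classical
  obtain ⟨v, hv, hv0⟩ := (Submodule.ne_bot_iff _).mp h
  set c : Word m n → k := wordCoord k m n (v : TensorPower k n (Fin m → k)) with hc_def
  have hc : c ∈ weightSpace (wordRep k m n) γ := by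
    intro t ht
    rw [hc_def, ← wordCoord_glTensorRep, ← coe_weylRep_apply, hv t ht, Submodule.coe_smul,
      map_smul]
  have hc0 : c ≠ 0 := by
    intro h0
    apply hv0
    have h1 : (v : TensorPower k n (Fin m → k)) = 0 := by
      rw [← (wordCoord k m n).map_eq_zero_iff, ← hc_def, h0]
    exact (Submodule.coe_eq_zero (x := v)).mp h1
  obtain ⟨w, hw⟩ := Function.ne_iff.mp hc0
  refine ⟨w, fun i => ?_⟩
  by_contra hne
  exact hw (Literature.NumberTheory.DiophantineGeometry.apply_eq_zero_of_mem_weightSpace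
    (hc := hc) (w := w) (i := i) (hw := fun h' => hne h'.symm))

/-- A function `c : [m] → ℕ` with `∑ c = d` is, up to a permutation of `[m]`, a partition of `d`
with at most `m` parts padded by zeros (sort it). [folklore] -/
private theorem exists_partition_perm_eq {d : ℕ} (c : Fin m → ℕ) (hcd : ∑ i, c i = d) :
    ∃ ϱ : Nat.Partition d, ϱ.parts.card ≤ m ∧ ∃ π : Equiv.Perm (Fin m),
      ∀ i, (c i : ℤ) = Weight.ofPartition m ϱ (π i) := by
  classical
  set σ : Equiv.Perm (Fin m) := Tuple.sort fun i => -(c i : ℤ) with hσ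
  have hmono : Monotone ((fun i => -(c i : ℤ)) ∘ σ) := Tuple.monotone_sort _
  set χ : Weight (Fin m) := fun i => (c (σ i) : ℤ) with hχ
  have hanti : χ.IsDominant := fun a b hab => by
    have h1 := hmono hab
    simp only [Function.comp_apply, neg_le_neg_iff] at h1
    exact h1
  have hpol : χ.IsPolynomial := ⟨hanti, fun i => by simp [hχ]⟩
  obtain ⟨ϱ₀, ⟨hϱ₀, hϱ₀χ⟩, -⟩ := Weight.existsUnique_eq_ofPartition_holds hpol
  have hsize : χ.size.toNat = d := by
    have h1 : χ.size = ((∑ i, c i : ℕ) : ℤ) := by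
      simp only [Weight.size, hχ, Nat.cast_sum]
      exact Equiv.sum_comp σ (fun i => (c i : ℤ))
    rw [h1, Int.toNat_natCast, hcd]
  refine ⟨⟨ϱ₀.parts, ϱ₀.parts_pos, by rw [ϱ₀.parts_sum, hsize]⟩, by simpa using hϱ₀, σ.symm,
    fun i => ?_⟩
  have h1 := congrFun hϱ₀χ (σ.symm i)
  simp only [hχ, Equiv.apply_symm_apply] at h1
  rw [← h1]
  rfl

/-- **IK §9 (TeX L813–814): `{λ}^{ℤ_D^m} = ⊕_ϱ W'_ϱ`.** In the Weyl module `{λ}`, `λ ⊢ dD`, of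
`GL_m` (characteristic zero) the sum of the weight spaces of the weights divisible by `D` is the
sum over the partitions `ϱ ⊢ d` with at most `m` parts of the subspaces `W'_ϱ = {λ}_ϱ`
(`IK2020.contentSubspace`, "spanned by all semistandard tableaux of shape `λ` whose sorted content
is `ϱD`"): a nonzero weight space of `{λ} ⊆ (k^m)^{⊗dD}` has a content `γ ∈ ℕ^m`, `|γ| = dD`, as its
weight, and `γ = D·γ'` with `γ'` a permutation of a padded partition of `d`.
[cite: IkenmeyerKandasamy2019, §9 (TeX L813–814)] -/
theorem iSup_weightSpace_dvd_eq_iSup_contentSubspace [CharZero k] {d D : ℕ} (hD : D ≠ 0)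
    (lam : Nat.Partition (d * D)) :
    (⨆ (γ : Weight (Fin m)) (_ : ∀ i, (D : ℤ) ∣ γ i),
        weightSpace (V := weylModule k (Fin m) lam) (weylRep k (Fin m) lam) γ) =
      ⨆ ϱ ∈ (Finset.univ : Finset (Nat.Partition d)).filter (fun ϱ => ϱ.parts.card ≤ m),
        contentSubspace k m D lam ϱ := by
  classical
  apply le_antisymm
  · refine iSup₂_le fun γ hγ => ?_
    by_cases hbot : weightSpace (V := weylModule k (Fin m) lam) (weylRep k (Fin m) lam) γ = ⊥
    · rw [hbot]
      exact bot_le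
    obtain ⟨w, hw⟩ := exists_wordContent_of_weightSpace_ne_bot lam hbot
    have hdvd : ∀ i, D ∣ wordContent w i := fun i => by
      have h1 := hγ i
      rw [hw i] at h1
      exact_mod_cast h1
    obtain ⟨c, hcD⟩ : ∃ c : Fin m → ℕ, ∀ i, wordContent w i = D * c i :=
      ⟨fun i => wordContent w i / D, fun i => (Nat.mul_div_cancel' (hdvd i)).symm⟩
    have hsum : ∑ i, c i = d := by
      have h2 : D * ∑ i, c i = D * d := by
        rw [Finset.mul_sum]
        simp_rw [← hcD]
        rw [sum_wordContent w, mul_comm]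
      exact Nat.eq_of_mul_eq_mul_left (Nat.pos_of_ne_zero hD) h2
    obtain ⟨ϱ, hϱ, π, hπ⟩ := exists_partition_perm_eq c hsum
    have hγ' : γ = fun i => (D : ℤ) * Weight.ofPartition m ϱ (π i) := by
      funext i
      rw [hw i, hcD i, Nat.cast_mul, hπ i]
    have hmem : ϱ ∈ (Finset.univ : Finset (Nat.Partition d)).filter
        (fun ϱ => ϱ.parts.card ≤ m) := Finset.mem_filter.mpr ⟨Finset.mem_univ _, hϱ⟩
    refine le_trans ?_ (le_iSup₂_of_le ϱ hmem le_rfl)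
    unfold contentSubspace
    rw [hγ']
    exact le_iSup (fun τ : Equiv.Perm (Fin m) => weightSpace (V := weylModule k (Fin m) lam)
      (weylRep k (Fin m) lam) fun i => (D : ℤ) * Weight.ofPartition m ϱ (τ i)) π
  · refine iSup₂_le fun ϱ _ => iSup_le fun π => ?_
    exact le_iSup₂_of_le (f := fun (γ : Weight (Fin m)) (_ : ∀ i, (D : ℤ) ∣ γ i) =>
        weightSpace (V := weylModule k (Fin m) lam) (weylRep k (Fin m) lam) γ)
      (fun i => (D : ℤ) * Weight.ofPartition m ϱ (π i)) (fun i => dvd_mul_right _ _) le_rfl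

/-- **IK §9 (TeX L814–815): "The action of `𝔖_m` leaves `W'_ϱ` fixed."** The permutation
matrices map `{λ}_ϱ` into itself (they permute the weight spaces, Fulton–Harris §15.3, tree
`IK2020.permGL_mem_weightSpace`, and `𝔖_m ϱ` is an orbit). [cite: IkenmeyerKandasamy2019, §9 (TeX L814–815)] -/
theorem weylRep_permGL_mem_contentSubspace {n d : ℕ} (D : ℕ) (lam : Nat.Partition n)
    (ϱ : Nat.Partition d) (π : Equiv.Perm (Fin m)) {v : weylModule k (Fin m) lam}
    (hv : v ∈ contentSubspace k m D lam ϱ) :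
    weylRep k (Fin m) lam (permGL k π) v ∈ contentSubspace k m D lam ϱ := by
  suffices h : contentSubspace k m D lam ϱ ≤
      (contentSubspace k m D lam ϱ).comap (weylRep k (Fin m) lam (permGL k π)) from h hv
  refine iSup_le fun σ => fun u hu => ?_
  rw [Submodule.mem_comap]
  have h1 := permGL_mem_weightSpace (V := weylModule k (Fin m) lam) (weylRep k (Fin m) lam) hu π
  exact Submodule.mem_iSup_of_mem (π.symm.trans σ) h1

/-- Distinct partitions (with at most `m` parts) give disjoint `𝔖_m`-orbits of padded weights:
if `D·(ϱ ∘ σ) = D·(ϱ' ∘ σ')` then `ϱ = ϱ'` (the antitone rearrangement of a tuple is unique,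
Mathlib `Tuple.unique_antitone`; `Weight.ofPartition` is injective). [folklore] -/
private theorem partition_eq_of_weight_eq {d D : ℕ} (hD : D ≠ 0) {ϱ ϱ' : Nat.Partition d}
    (hϱ : ϱ.parts.card ≤ m) (hϱ' : ϱ'.parts.card ≤ m) {σ σ' : Equiv.Perm (Fin m)}
    (h : (fun i => (D : ℤ) * Weight.ofPartition m ϱ (σ i)) =
      fun i => (D : ℤ) * Weight.ofPartition m ϱ' (σ' i)) : ϱ = ϱ' := by
  have hD' : (D : ℤ) ≠ 0 := by exact_mod_cast hD
  set f : Fin m → ℤ := Weight.ofPartition m ϱ ∘ σ with hf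
  have hf' : f = Weight.ofPartition m ϱ' ∘ σ' := by
    funext i
    exact mul_left_cancel₀ hD' (congrFun h i)
  have hA : f ∘ ⇑σ⁻¹ = Weight.ofPartition m ϱ := by
    funext i
    simp [hf]
  have hB : f ∘ ⇑σ'⁻¹ = Weight.ofPartition m ϱ' := by
    funext i
    simp [hf']
  have hanti : Antitone (f ∘ ⇑σ⁻¹) := by
    rw [hA]
    exact (Weight.isPolynomial_ofPartition_holds m ϱ).1
  have hanti' : Antitone (f ∘ ⇑σ'⁻¹) := by
    rw [hB]
    exact (Weight.isPolynomial_ofPartition_holds m ϱ').1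
  have heq := Tuple.unique_antitone hanti hanti'
  rw [hA, hB] at heq
  exact Weight.ofPartition_injOn_holds m d hϱ hϱ' heq

/-- The finite set `𝔖_m · (Dϱ)` of weights of the block `W'_ϱ`. [folklore] -/
private theorem contentSubspace_eq_iSup_image [DecidableEq (Weight (Fin m))] {n d : ℕ} (D : ℕ)
    (lam : Nat.Partition n) (ϱ : Nat.Partition d) :
    contentSubspace k m D lam ϱ =
      ⨆ γ ∈ (Finset.univ : Finset (Equiv.Perm (Fin m))).image
          (fun σ : Equiv.Perm (Fin m) => fun i => (D : ℤ) * Weight.ofPartition m ϱ (σ i)),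
        weightSpace (V := weylModule k (Fin m) lam) (weylRep k (Fin m) lam) γ := by
  unfold contentSubspace
  apply le_antisymm
  · exact iSup_le fun σ => le_iSup₂_of_le
      (f := fun (γ : Weight (Fin m)) (_ : γ ∈ (Finset.univ : Finset (Equiv.Perm (Fin m))).image
          (fun σ : Equiv.Perm (Fin m) => fun i => (D : ℤ) * Weight.ofPartition m ϱ (σ i))) =>
        weightSpace (V := weylModule k (Fin m) lam) (weylRep k (Fin m) lam) γ)
      (fun i => (D : ℤ) * Weight.ofPartition m ϱ (σ i))
      (Finset.mem_image_of_mem _ (Finset.mem_univ σ)) le_rfl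
  · refine iSup₂_le fun γ hγ => ?_
    obtain ⟨σ, -, rfl⟩ := Finset.mem_image.mp hγ
    exact le_iSup (fun σ : Equiv.Perm (Fin m) => weightSpace (V := weylModule k (Fin m) lam)
      (weylRep k (Fin m) lam) fun i => (D : ℤ) * Weight.ofPartition m ϱ (σ i)) σ

/-- **IK §9 (TeX L813–814): the decomposition `⊕_ϱ W'_ϱ` is direct.** The subspaces
`{λ}_ϱ ⊆ {λ}`, `ϱ ⊢ d` with at most `m` parts, are independent: their weights `𝔖_m·(Dϱ)` are
pairwise disjoint sets and weight vectors of distinct weights are linearly independent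
(characteristic zero). [cite: IkenmeyerKandasamy2019, §9 (TeX L813–814)] -/
theorem contentSubspace_independent [CharZero k] {n d D : ℕ} (hD : D ≠ 0)
    (lam : Nat.Partition n) (v : Nat.Partition d → weylModule k (Fin m) lam)
    (hv : ∀ ϱ ∈ (Finset.univ : Finset (Nat.Partition d)).filter (fun ϱ => ϱ.parts.card ≤ m),
      v ϱ ∈ contentSubspace k m D lam ϱ)
    (h0 : ∑ ϱ ∈ (Finset.univ : Finset (Nat.Partition d)).filter (fun ϱ => ϱ.parts.card ≤ m),
      v ϱ = 0) :
    ∀ ϱ ∈ (Finset.univ : Finset (Nat.Partition d)).filter (fun ϱ => ϱ.parts.card ≤ m),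
      v ϱ = 0 := by
  classical
  haveI : Infinite k := Infinite.of_injective _ (Nat.cast_injective (R := k))
  refine eq_zero_of_sum_mem_iSup_weightSpace (V := weylModule k (Fin m) lam)
    (weylRep k (Fin m) lam) _
    (fun ϱ => (Finset.univ : Finset (Equiv.Perm (Fin m))).image
      (fun σ : Equiv.Perm (Fin m) => fun i => (D : ℤ) * Weight.ofPartition m ϱ (σ i)))
    (fun ϱ hϱ ϱ' hϱ' hne => ?_) v (fun ϱ hϱ => ?_) h0
  · rw [Finset.disjoint_left]
    intro γ hγ hγ'
    obtain ⟨σ, -, rfl⟩ := Finset.mem_image.mp hγ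
    obtain ⟨σ', -, hσ'⟩ := Finset.mem_image.mp hγ'
    exact hne (partition_eq_of_weight_eq hD (Finset.mem_filter.mp hϱ).2
      (Finset.mem_filter.mp hϱ').2 hσ'.symm)
  · rw [← contentSubspace_eq_iSup_image]
    exact hv ϱ hϱ

/-- **IK §9 (TeX L815–816): `({λ}^{ℤ_D^m})^{𝔖_m} = ⊕_ϱ (W'_ϱ)^{𝔖_m}`**, in dimensions:
`dim (⊕_{ϱ ⊢_m d} {λ}_ϱ)^{𝔖_m} = ∑_{ϱ ⊢_m d} dim ({λ}_ϱ)^{𝔖_m}` (the blocks are `𝔖_m`-stable and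
independent). [cite: IkenmeyerKandasamy2019, §9 (TeX L815–816)] -/
theorem finrank_permFixed_iSup_contentSubspace_eq_sum [CharZero k] {n d D : ℕ} (hD : D ≠ 0)
    (lam : Nat.Partition n) :
    finrank k (permFixed k lam Set.univ
        (⨆ ϱ ∈ (Finset.univ : Finset (Nat.Partition d)).filter (fun ϱ => ϱ.parts.card ≤ m),
          contentSubspace k m D lam ϱ)) =
      ∑ ϱ ∈ (Finset.univ : Finset (Nat.Partition d)).filter (fun ϱ => ϱ.parts.card ≤ m),
        finrank k (permFixed k lam Set.univ (contentSubspace k m D lam ϱ)) := by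
  have hind := contentSubspace_independent (k := k) (m := m) (D := D) (d := d) hD lam
  have hT : ∀ (π : Equiv.Perm (Fin m)),
      ∀ ϱ ∈ (Finset.univ : Finset (Nat.Partition d)).filter (fun ϱ => ϱ.parts.card ≤ m),
      ∀ v ∈ contentSubspace k m D lam ϱ,
        weylRep k (Fin m) lam (permGL k π) v ∈ contentSubspace k m D lam ϱ :=
    fun π ϱ _ v hv => weylRep_permGL_mem_contentSubspace D lam ϱ π hv
  have memF : ∀ v : weylModule k (Fin m) lam,
      v ∈ (⨅ π ∈ (Set.univ : Set (Equiv.Perm (Fin m))),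
        LinearMap.eqLocus (weylRep k (Fin m) lam (permGL k π)) LinearMap.id) ↔
      ∀ π, weylRep k (Fin m) lam (permGL k π) v = v := fun v => by
    simp only [Submodule.mem_iInf, LinearMap.mem_eqLocus, LinearMap.id_coe, id_eq, Set.mem_univ,
      forall_const]
  have key := finrank_iSup_inf_eq_sum (V := weylModule k (Fin m) lam)
    ((Finset.univ : Finset (Nat.Partition d)).filter (fun ϱ => ϱ.parts.card ≤ m))
    (fun ϱ => contentSubspace k m D lam ϱ) hind (fun π => weylRep k (Fin m) lam (permGL k π))
    hT _ memF
  unfold permFixed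
  exact key

end Content

/-! ## §4. `{λ}^H = (⊕_ϱ W'_ϱ)^{𝔖_m}` and the dimension formula -/

section Assembly

variable {k : Type*} [Field k] [CharZero k] {m : ℕ}

/-- **IK §9 (TeX L804–805): "`{λ}^H = ({λ}^{ℤ_D^m})^{𝔖_m}`", made explicit.** For the subgroup
of `GL_m(k)` generated by the permutation matrices and the diagonal matrices of `D`-th roots of
unity (`= stab(x₁^D + ⋯ + x_m^D)` by BI 2017 Prop. 2.4(2), tree `linStabilizer_psum_eq_closure`),
`k` containing a primitive `D`-th root of unity, the invariants of the Weyl module `{λ}`,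
`λ ⊢ dD`, are the `𝔖_m`-fixed vectors of `⊕_{ϱ ⊢_m d} {λ}_ϱ`.
[cite: IkenmeyerKandasamy2019, §9 (TeX L804–805)] -/
theorem invariants_weylRep_closure_eq_permFixed {d D : ℕ} (hD : D ≠ 0) {ζ : k}
    (hζ : IsPrimitiveRoot ζ D) (lam : Nat.Partition (d * D)) :
    Representation.invariants (k := k) (V := weylModule k (Fin m) lam)
        ((weylRep k (Fin m) lam).comp (Subgroup.closure
          ({γ : GL (Fin m) k | ∃ π : Equiv.Perm (Fin m),
              (γ : Matrix (Fin m) (Fin m) k) = π.permMatrix k} ∪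
           {γ : GL (Fin m) k | ∃ t : Fin m → k,
              (γ : Matrix (Fin m) (Fin m) k) = Matrix.diagonal t ∧ ∀ i, t i ^ D = 1})).subtype) =
      permFixed k lam Set.univ
        (⨆ ϱ ∈ (Finset.univ : Finset (Nat.Partition d)).filter (fun ϱ => ϱ.parts.card ≤ m),
          contentSubspace k m D lam ϱ) := by
  classical
  haveI : Infinite k := Infinite.of_injective _ (Nat.cast_injective (R := k))
  have hrat : IsRationalRep (V := weylModule k (Fin m) lam) (weylRep k (Fin m) lam) :=
    (isPolynomialRep_weylRep_holds k (Fin m) lam).isRationalRep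
  have htorus := iInf_eqLocus_rootDiagonal_eq_iSup_weightSpace (V := weylModule k (Fin m) lam)
    (weylRep k (Fin m) lam) hrat hD hζ
  rw [iSup_weightSpace_dvd_eq_iSup_contentSubspace hD lam] at htorus
  ext v
  rw [mem_invariants_comp_subtype_closure_iff]
  unfold permFixed
  rw [← htorus, Submodule.mem_inf]
  simp only [Submodule.mem_iInf, LinearMap.mem_eqLocus, LinearMap.id_coe, id_eq, Set.mem_univ,
    Set.mem_setOf_eq, forall_const]
  constructor
  · intro hv
    refine ⟨fun t ht => hv t (Or.inr ht), fun π => hv _ (Or.inl ⟨π⁻¹, ?_⟩)⟩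
    rw [coe_permGL]
  · rintro ⟨h1, h2⟩ s hs
    rcases hs with ⟨π, hπ⟩ | ht
    · have hs' : s = permGL k π⁻¹ := Units.ext (by rw [hπ, coe_permGL, inv_inv])
      rw [hs']
      exact h2 π⁻¹
    · exact h1 s ht

/-- **IK Prop. 9.2 / §10 (TeX L815–820, L844–846), dimension form:
`dim {λ}^H = ∑_{ϱ ⊢_m d} dim ({λ}_ϱ)^{𝔖_m}`** for `H = stab(x₁^D + ⋯ + x_m^D) ≤ GL_m(k)`, `D ≥ 3`,
`λ ⊢ dD`, over any field of characteristic zero containing a primitive `D`-th root of unity —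
unconditionally (no Schur–Weyl input). With Prop. 10.1 (`dim ({λ}_ϱ)^{𝔖_m} = b(λ,ϱ,D,d)`) this is
Prop. 4.1, see `IK2020_prop_4_1_of_prop_10_1`. [cite: IkenmeyerKandasamy2019, Prop. 9.2] -/
theorem weylInvariantDim_psum_eq_sum_finrank_permFixed (m : ℕ) {d D : ℕ} (hD : 3 ≤ D) {ζ : k}
    (hζ : IsPrimitiveRoot ζ D) (lam : Nat.Partition (d * D)) :
    weylInvariantDim k m lam (linStabilizer (psum (Fin m) k D)) =
      ∑ ϱ ∈ (Finset.univ : Finset (Nat.Partition d)).filter (fun ϱ => ϱ.parts.card ≤ m),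
        finrank k (permFixed k lam Set.univ (contentSubspace k m D lam ϱ)) := by
  have hcl : linStabilizer (psum (Fin m) k D) =
      Subgroup.closure
        ({γ : GL (Fin m) k | ∃ π : Equiv.Perm (Fin m),
            (γ : Matrix (Fin m) (Fin m) k) = π.permMatrix k} ∪
         {γ : GL (Fin m) k | ∃ t : Fin m → k,
            (γ : Matrix (Fin m) (Fin m) k) = Matrix.diagonal t ∧ ∀ i, t i ^ D = 1}) :=
    linStabilizer_psum_eq_closure (by omega)
  unfold weylInvariantDim
  rw [hcl, invariants_weylRep_closure_eq_permFixed (by omega) hζ lam,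
    finrank_permFixed_iSup_contentSubspace_eq_sum (by omega) lam]

end Assembly

/-- **IK Prop. 9.2 over `ℂ`**: `dim {λ}^H = ∑_{ϱ ⊢_m d} dim ({λ}_ϱ)^{𝔖_m}`, `H = stab(x₁^D + ⋯ + x_m^D)`,
`D ≥ 3`, `λ ⊢ dD` (primitive root `e^{2πi/D}`). [cite: IkenmeyerKandasamy2019, Prop. 9.2] -/
theorem weylInvariantDim_psum_eq_sum_finrank_permFixed_complex (m : ℕ) {d D : ℕ} (hD : 3 ≤ D)
    (lam : Nat.Partition (d * D)) :
    weylInvariantDim ℂ m lam (linStabilizer (psum (Fin m) ℂ D)) =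
      ∑ ϱ ∈ (Finset.univ : Finset (Nat.Partition d)).filter (fun ϱ => ϱ.parts.card ≤ m),
        finrank ℂ (permFixed ℂ lam Set.univ (contentSubspace ℂ m D lam ϱ)) :=
  weylInvariantDim_psum_eq_sum_finrank_permFixed m hD
    (Complex.isPrimitiveRoot_exp D (by omega)) lam

end IK2020

open IK2020 in
/-- **The printed proof of IK Prop. 4.1 (§10, TeX L844–846) modulo Prop. 10.1**:
`mult_{λ^*} ℂ[Gp] = dim {λ}^H = ∑_{ϱ ⊢_m d} dim ({λ}_ϱ)^{𝔖_m}` (§9, proved above unconditionally)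
`= ∑_{ϱ ⊢_m d} b(λ,ϱ,D,d)` (Prop. 10.1, the named fact `IK2020_prop_10_1`). Thus the named fact
`IK2020_prop_4_1` follows from `IK2020_prop_10_1`. [cite: IkenmeyerKandasamy2019, Prop. 4.1 (proof, §10)] -/
theorem IK2020_prop_4_1_of_prop_10_1 (h : IK2020_prop_10_1) : IK2020_prop_4_1 := by
  intro m D d hD hDm lam hlam
  rw [weylInvariantDim_psum_eq_sum_finrank_permFixed_complex m hD lam]
  exact Finset.sum_congr rfl fun ϱ hϱ => h m D d hD hDm lam hlam ϱ (Finset.mem_filter.mp hϱ).2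

end Literature.Computability.AlgebraicComplexity

end
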